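import Summits.BirchSwinnertonDyer.BirchSwinnertonDyer.Theorems.ResidualThetaTransportAtTwoSignedMuSeedAtTwoPlusJetRobertTorsion
import HarnessLib

/-!
# The `[2]`-orbit of a point on `Ẽ : y² + y = x³` (char `2`): `x(2ⁱP) = x(P)^{4ⁱ}`, the pole-coordinate sum `p₁ = Σ_{i<n} x^{4ⁱ}` is a
# partial `𝔽₄`-trace with `p₁⁴ = p₁` as soon as `2ⁿP = ±P`, and `NonDeg(1) ⟺ p₁ ≠ 0` for the `𝔣₀ = 1` Robert function on that orbit
# (seed lines `norm-field-tilt` S4 / `jet-character-sums` J5 at `𝔣₀ = 1`; crux `SignedMuSeedAtTwoPlus` stmt-BirchSwinnertonDyer-21438; Kμ⁺ stmt-BirchSwinnertonDyer-20689)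

Cell `bsd-wall`, width seat `bsd-wall-rtt-p4-w2` g14 (`--supports`, closes nothing).  THEOREMS ONLY; the lines are NOT registered (W-79);
BSD is not proved by this.

For a cyclic subgroup `C = ⟨P⟩ ⊂ Ẽ` of odd prime order `ℓ` the poles of the `𝔣₀ = 1` Robert function are `x((C∖O)/±)`; when `−2` generates
`(ℤ/ℓ)^×/±1` (e.g. `ℓ = 3, 5, 7, 11, 13, 17`) a system of representatives is `{2ⁱP : i < (ℓ−1)/2}`, and by `…JetRobertTorsion.add_self_eq_neg_frob`
(`[2] = −Frob₄` on points) the pole coordinates are `x(P)^{4ⁱ}`.  Proved here (any model `a₁ = a₂ = a₄ = a₆ = 0`, `a₃ = 1` over a field of char `2`):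

* §1 **`two_pow_nsmul_eq`**: `2ⁱ·P = (x^{4ⁱ}, yᵢ)` for some `yᵢ` (induction on `add_self_eq_neg_frob`); `x_pow_four_pow_eq_of_two_pow_nsmul_eq(_neg)`
  (`2ⁿP = ±P ⟹ x^{4ⁿ} = x`); `x_pow_four_eq_of_three_nsmul_eq_zero` (`3P = O ⟹ x⁴ = x`, converse of `add_self_eq_neg_of_pow_four_eq`: `Ẽ[3] = Ẽ(𝔽₄)`-coordinates).
* §2 **`orbitSum_pow_four`**: `(Σ_{i<n} x^{4ⁱ})⁴ = Σ_{i<n} x^{4ⁱ} − x + x^{4ⁿ}` (any commutative ring of char `2`), hence **`orbitSum_pow_four_eq_self`**: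
  `2ⁿP = ±P ⟹ p₁⁴ = p₁` for `p₁ := Σ_{i<n} x(P)^{4ⁱ}` — `p₁ ∈ 𝔽₄`, and `p₁ ≠ 0 ⟹ p₁³ = 1` (`…JetRobertTorsion.pow_three_eq_one_of_pow_four_eq`).
* §3 **`nonDeg_one_orbit`**: for the Robert function `∏_{i<n} 1/(x + x(P)^{4ⁱ})` (factors `θᵢ(t + x^{4ⁱ}w) = w`), `λ² + λ + 1 = 0`, `δ ≡ ūt⁴ (mod t⁸)`,
  `ū² + ū + 1 = 0`: `p₁ ≠ 0 ⟹ ord S₀ = 4 ∧ ord S₁ = 12` (`NonDeg(1)`), and `p₁ = 0 ⟹ t¹² ∣ S₀ ∧ t¹⁴ ∣ S₁` — so at `𝔣₀ = 1` the line's J5 is, prime by prime,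
  the non-vanishing of the partial `𝔽₄`-trace `Σ_{i<(ℓ−1)/2} x(P)^{4ⁱ}` of a generator's `x`-coordinate (`ℓ = 5`: `Tr_{𝔽₁₆/𝔽₄}`, never `0`, `…JetRobertTorsion`).

References: [SilvermanAEC2009] III.2.3; the cards. [folklore]
-/

set_option autoImplicit false
-- the Theorems namespace of this sub repeats the summit name by design (D-0017 nested layout)
set_option linter.dupNamespace false

noncomputable section

open PowerSeries Finset

namespace Summit.BirchSwinnertonDyer.BirchSwinnertonDyer.Theorems.SignedMuAtTwo.JetCharacterSums

/-! ## §1 `x(2ⁱP) = x^{4ⁱ}` -/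

section Orbit

variable {K : Type*} [Field K] [CharP K 2] [DecidableEq K] (E : WeierstrassCurve.Affine K)
  (h₁ : E.a₁ = 0) (h₂ : E.a₂ = 0) (h₃ : E.a₃ = 1) (h₄ : E.a₄ = 0) (h₆ : E.a₆ = 0)

include h₁ h₂ h₃ h₄ h₆

/-- **`2ⁱ·P = (x^{4ⁱ}, yᵢ)`**: the `x`-coordinate of `2ⁱP` is `x(P)^{4ⁱ}` (`[2] = −Frob₄`, iterated; `x(−Q) = x(Q)`). [cite: SilvermanAEC2009, III.2.3] -/
theorem two_pow_nsmul_eq {x y : K} (h : E.Nonsingular x y) (i : ℕ) :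
    ∃ (y' : K) (h' : E.Nonsingular (x ^ 4 ^ i) y'),
      (2 ^ i : ℕ) • WeierstrassCurve.Affine.Point.some x y h = WeierstrassCurve.Affine.Point.some (x ^ 4 ^ i) y' h' := by
  induction i with
  | zero => exact ⟨y, by rw [pow_zero, pow_one]; exact h, by simp⟩
  | succ i ih =>
    obtain ⟨y', h', he⟩ := ih
    refine ⟨E.negY ((x ^ 4 ^ i) ^ 4) (y' ^ 4), ?_, ?_⟩
    · rw [pow_succ, pow_mul]
      exact (WeierstrassCurve.Affine.nonsingular_neg _ _).mpr (nonsingular_frob E h₁ h₂ h₃ h₄ h₆ h')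
    · rw [pow_succ', mul_nsmul', he, two_nsmul, add_self_eq_neg_frob E h₁ h₂ h₃ h₄ h₆ h', WeierstrassCurve.Affine.Point.neg_some,
        WeierstrassCurve.Affine.Point.some.injEq]
      exact ⟨by rw [← pow_mul, ← pow_succ], rfl⟩

/-- `2ⁿP = P ⟹ x^{4ⁿ} = x`. [folklore] -/
theorem x_pow_four_pow_eq_of_two_pow_nsmul_eq {x y : K} (h : E.Nonsingular x y) {n : ℕ}
    (hn : (2 ^ n : ℕ) • WeierstrassCurve.Affine.Point.some x y h = WeierstrassCurve.Affine.Point.some x y h) : x ^ 4 ^ n = x := by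
  obtain ⟨y', h', he⟩ := two_pow_nsmul_eq E h₁ h₂ h₃ h₄ h₆ h n
  rw [he, WeierstrassCurve.Affine.Point.some.injEq] at hn
  exact hn.1

/-- `2ⁿP = −P ⟹ x^{4ⁿ} = x`. [folklore] -/
theorem x_pow_four_pow_eq_of_two_pow_nsmul_eq_neg {x y : K} (h : E.Nonsingular x y) {n : ℕ}
    (hn : (2 ^ n : ℕ) • WeierstrassCurve.Affine.Point.some x y h = -WeierstrassCurve.Affine.Point.some x y h) : x ^ 4 ^ n = x := by
  obtain ⟨y', h', he⟩ := two_pow_nsmul_eq E h₁ h₂ h₃ h₄ h₆ h n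
  rw [he, WeierstrassCurve.Affine.Point.neg_some, WeierstrassCurve.Affine.Point.some.injEq] at hn
  exact hn.1

/-- **`3P = O ⟹ x(P)⁴ = x(P)`** (`2P = −P = −Frob₄P` forces `Frob₄P = P`): together with `add_self_eq_neg_of_pow_four_eq`, `Ẽ[3] ∖ O` is exactly the set of
points with `x ∈ 𝔽₄` (`Ẽ[3] = Ẽ(𝔽₄)`). [cite: SilvermanAEC2009, III.2.3] -/
theorem x_pow_four_eq_of_three_nsmul_eq_zero {x y : K} (h : E.Nonsingular x y)
    (h3 : (3 : ℕ) • WeierstrassCurve.Affine.Point.some x y h = 0) : x ^ 4 = x := by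
  have h2 : (2 ^ 1 : ℕ) • WeierstrassCurve.Affine.Point.some x y h = -WeierstrassCurve.Affine.Point.some x y h := by
    rw [← sub_eq_zero, sub_neg_eq_add, pow_one, ← succ_nsmul]
    exact h3
  have hx := x_pow_four_pow_eq_of_two_pow_nsmul_eq_neg E h₁ h₂ h₃ h₄ h₆ h h2
  rwa [pow_one] at hx

end Orbit

/-! ## §2 The orbit sum `p₁ = Σ_{i<n} x^{4ⁱ}`: `p₁⁴ = p₁ − x + x^{4ⁿ}` -/

section OrbitSum

variable {R : Type*} [CommRing R] [CharP R 2]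

/-- **`(Σ_{i<n} x^{4ⁱ})⁴ = Σ_{i<n} x^{4ⁱ} − x + x^{4ⁿ}`** (characteristic `2`: the fourth power shifts the partial trace by one). [folklore] -/
theorem orbitSum_pow_four (x : R) (n : ℕ) :
    (∑ i ∈ range n, x ^ 4 ^ i) ^ 4 = (∑ i ∈ range n, x ^ 4 ^ i) - x + x ^ 4 ^ n := by
  have hfrob : (∑ i ∈ range n, x ^ 4 ^ i) ^ 4 = ∑ i ∈ range n, x ^ 4 ^ (i + 1) := by
    rw [show (4 : ℕ) = 2 * 2 from rfl, pow_mul, sum_pow_char 2 (range n), sum_pow_char 2 (range n)]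
    refine Finset.sum_congr rfl fun i _ => ?_
    conv_rhs => rw [pow_succ, pow_mul]
    ring
  rw [hfrob]
  have h := Finset.sum_range_succ' (fun i => x ^ 4 ^ i) n
  have h' := Finset.sum_range_succ (fun i => x ^ 4 ^ i) n
  simp only [pow_zero, pow_one] at h
  linear_combination h' - h

/-- `x^{4ⁿ} = x ⟹ p₁⁴ = p₁` for `p₁ = Σ_{i<n} x^{4ⁱ}` (`p₁ ∈ 𝔽₄`). [folklore] -/
theorem orbitSum_pow_four_eq_self_of_pow_eq {x : R} {n : ℕ} (hx : x ^ 4 ^ n = x) :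
    (∑ i ∈ range n, x ^ 4 ^ i) ^ 4 = ∑ i ∈ range n, x ^ 4 ^ i := by
  rw [orbitSum_pow_four, hx, sub_add_cancel]

end OrbitSum

section OrbitSumPoint

variable {K : Type*} [Field K] [CharP K 2] [DecidableEq K] (E : WeierstrassCurve.Affine K)
  (h₁ : E.a₁ = 0) (h₂ : E.a₂ = 0) (h₃ : E.a₃ = 1) (h₄ : E.a₄ = 0) (h₆ : E.a₆ = 0)

include h₁ h₂ h₃ h₄ h₆

/-- **`2ⁿP = ±P ⟹ p₁⁴ = p₁`** for the pole-coordinate sum `p₁ = Σ_{i<n} x(P)^{4ⁱ} = Σ_{i<n} x(2ⁱP)` of the `[2]`-orbit (for `C = ⟨P⟩` of prime order `ℓ`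
with `−2` generating `(ℤ/ℓ)^×/±1` and `n = (ℓ−1)/2` this is `p₁(C) = Σ_{Q∈(C∖O)/±} x(Q) = Tr_{𝔽₄(x)/𝔽₄} x(P) ∈ 𝔽₄`). [folklore] -/
theorem orbitSum_pow_four_eq_self {x y : K} (h : E.Nonsingular x y) {n : ℕ}
    (hn : (2 ^ n : ℕ) • WeierstrassCurve.Affine.Point.some x y h = WeierstrassCurve.Affine.Point.some x y h ∨
      (2 ^ n : ℕ) • WeierstrassCurve.Affine.Point.some x y h = -WeierstrassCurve.Affine.Point.some x y h) :
    (∑ i ∈ range n, x ^ 4 ^ i) ^ 4 = ∑ i ∈ range n, x ^ 4 ^ i := by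
  refine orbitSum_pow_four_eq_self_of_pow_eq ?_
  rcases hn with hn | hn
  · exact x_pow_four_pow_eq_of_two_pow_nsmul_eq E h₁ h₂ h₃ h₄ h₆ h hn
  · exact x_pow_four_pow_eq_of_two_pow_nsmul_eq_neg E h₁ h₂ h₃ h₄ h₆ h hn

/-- `2ⁿP = ±P` and `p₁ ≠ 0` ⟹ `p₁³ = 1`: the non-degenerate wall value `[t¹²]S₁ = p₁²` is a cube root of unity. [folklore] -/
theorem orbitSum_pow_three_eq_one {x y : K} (h : E.Nonsingular x y) {n : ℕ}
    (hn : (2 ^ n : ℕ) • WeierstrassCurve.Affine.Point.some x y h = WeierstrassCurve.Affine.Point.some x y h ∨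
      (2 ^ n : ℕ) • WeierstrassCurve.Affine.Point.some x y h = -WeierstrassCurve.Affine.Point.some x y h)
    (hp : ∑ i ∈ range n, x ^ 4 ^ i ≠ 0) : (∑ i ∈ range n, x ^ 4 ^ i) ^ 3 = 1 :=
  pow_three_eq_one_of_pow_four_eq (orbitSum_pow_four_eq_self E h₁ h₂ h₃ h₄ h₆ h hn) hp

end OrbitSumPoint

/-! ## §3 `NonDeg(1)` for the Robert function on a `[2]`-orbit -/

section NonDeg

variable {K : Type*} [CommRing K] [CharP K 2]

/-- **`NonDeg(1) ⟺ p₁ ≠ 0` on a `[2]`-orbit**: Robert factors `θᵢ(t + x^{4ⁱ}w) = w` (`i < n`), `S₀ = λΦ(λt) + λ²Φ(λ²t)` with `Φ = Σθᵢ`, `λ² + λ + 1 = 0`,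
`δ ≡ ūt⁴ (mod t⁸)`, `ū² + ū + 1 = 0`, `p₁ = Σ_{i<n} x^{4ⁱ}`: over a reduced ring `p₁ ≠ 0 ⟹ ord S₀ = 4 ∧ ord S₁ = 12` (`12 + 2 < 4²`), and always
`p₁ = 0 ⟹ t¹² ∣ S₀ ∧ t¹⁴ ∣ S₁`. [folklore] -/
theorem nonDeg_one_orbit [IsReduced K] {x : K} {n : ℕ} {θ : ℕ → K⟦X⟧}
    (hθ : ∀ i ∈ range n, θ i * (X + C (x ^ 4 ^ i) * (⟨0, 0, 1, 0, 0⟩ : WeierstrassCurve K).formalW) = (⟨0, 0, 1, 0, 0⟩ : WeierstrassCurve K).formalW)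
    {l : K} (hl : l ^ 2 + l + 1 = 0) {δ : K⟦X⟧} {u : K} (hδ : (X : K⟦X⟧) ^ 8 ∣ δ - C u * X ^ 4) (hu : u ^ 2 + u + 1 = 0) :
    (∑ i ∈ range n, x ^ 4 ^ i ≠ 0 →
      PowerSeries.order (C l * rescale l (∑ i ∈ range n, θ i) + C (l ^ 2) * rescale (l ^ 2) (∑ i ∈ range n, θ i)) = ((4 : ℕ) : ℕ∞) ∧
      PowerSeries.order ((C l * rescale l (∑ i ∈ range n, θ i) + C (l ^ 2) * rescale (l ^ 2) (∑ i ∈ range n, θ i)) +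
        (C l * rescale l (∑ i ∈ range n, θ i) + C (l ^ 2) * rescale (l ^ 2) (∑ i ∈ range n, θ i)).subst (X + δ) : K⟦X⟧) =
          ((12 : ℕ) : ℕ∞)) ∧
    (∑ i ∈ range n, x ^ 4 ^ i = 0 →
      (X : K⟦X⟧) ^ 12 ∣ C l * rescale l (∑ i ∈ range n, θ i) + C (l ^ 2) * rescale (l ^ 2) (∑ i ∈ range n, θ i) ∧
      (X : K⟦X⟧) ^ 14 ∣ (C l * rescale l (∑ i ∈ range n, θ i) + C (l ^ 2) * rescale (l ^ 2) (∑ i ∈ range n, θ i)) +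
        (C l * rescale l (∑ i ∈ range n, θ i) + C (l ^ 2) * rescale (l ^ 2) (∑ i ∈ range n, θ i)).subst (X + δ)) := by
  refine ⟨fun hp => ?_, fun hp => (levelOne_robertSum_dichotomy hθ hl hδ hu).2.2.2.2 hp⟩
  have H := nonDeg_one_robertSum hθ hl hδ hu hp
  exact ⟨H.1, H.2.1⟩

end NonDeg

end Summit.BirchSwinnertonDyer.BirchSwinnertonDyer.Theorems.SignedMuAtTwo.JetCharacterSums

end
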